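import Summits.ValiantsHypothesis.ValiantsHypothesis.Theorems.KPlusLogSqLawTropicalBStaircaseDesign

/-!
# Route «KPlusLogSqLaw», crux `WeakLifting` (stmt-ValiantsHypothesis-19561), docket D2 — counting the PRESENT INCIDENCES of a walk design;
# the staircase layers are sparse (part 1 of «incidence-linear laws are false at `K = 4`»)

HONEST FRAMING.  Helper file (cell `pub-symmetroid`, seat val-sym-lift-p3 g26, 2026-08-29) `--supports` the crux `…Theses.KPlusLogSqLaw.WeakLifting`
(item `stmt-ValiantsHypothesis-19561`; lineage docket D2 = the `K = 4` exponent fork of the aside `Lifting`).  Pure counting over definitions already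
in the tree (the walk designs `walkEps` of `…TropicalBWalkDesignDefs`, seat val-sym-trop-p1, and the staircase layers `entryLayer` / `climbLayer` /
`exitLayer` / `gad` of `…DerivedPencilRolleStairDefs`); nothing is asserted about `WeakLifting`, `TropicalB`, `Lifting`, `TropK4Law 2`, `KPlusLogSqLaw`,
`MatrixDescartes` (stmt-ValiantsHypothesis-18050) or VP ≠ VNP.  No `def`.  The companion part 2 (`…TropicalStaircaseIncidences`) assembles these counts
with the tree's staircase walk system into: for every `C` a `K = 4` design whose sign-alternating dominant chain has more than `C × #present incidences`
alternations — the refutation of the incidence-linear reframing «S(4)» of `TropK4Law 2` (lineage README g25 (b); by `…TropicalFreshIncidences`,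
`n + m ≤ #used + Z`, so S(4) would have bounded the recombination count `Z`).
* `card_support_walkEps_le` — the present incidences `(a, b, l)` of ANY walk design number at most `m + Σ_t #edges(layer t) + |V|` (diagonal entries,
  layer entries, back entries; via the tree's `walkEpsP_cases`, `lay_of_layerEdge`);
* `card_edges_le_of_headDet` — a layer on `W × Bool` in which the head of an edge is determined by its tail and the head's flag has ≤ `2·|W × Bool|` edges;
* `headDet_entryLayer` / `headDet_exitLayer` / `headDet_climbLayer` / `headDet_of_mem_climbs` / `headDet_of_mem_stairJ` / `headDet_of_mem_gad` —
  every layer of the staircase gadget `𝒢_k(p)` has that property (entry: `(ρ,base)→(ρ,climb)`; climb: `(ρ,climb)→(ρ+1,climb)` or `(ρ,·)→(ρ,base)`;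
  exit: `(ρ,·)→(ρ,base)`), and it survives the restriction `finLayer R` to `Fin R × Bool` (`headDet_finLayer`, `iota` injective);
* `card_edges_staircase_layer_le` — hence every layer of the finite staircase graph has at most `2·|Fin R × Bool| = 4R` edges.
[folklore counting over the cited tree constructions]
-/

set_option linter.dupNamespace false
set_option autoImplicit false

namespace Summit.ValiantsHypothesis.ValiantsHypothesis.Theorems.KPlusLogSqLaw

open Summit.ValiantsHypothesis.ValiantsHypothesis.Theorems.MatrixDescartes.Negative
open Summit.ValiantsHypothesis.ValiantsHypothesis.Theorems.SymmetroidDescartes.DPR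
open Summit.ValiantsHypothesis.ValiantsHypothesis.Theorems.KPlusLogSqLaw.WalkDesign
open scoped BigOperators
open Finset

namespace StaircaseIncidences

/-! ## 1. Present incidences of a walk design: diagonal + layer edges + back entries -/

section Generic

variable {V : Type*} [Fintype V] [DecidableEq V] {T K m : ℕ}

/-- **Incidence count of a walk design.**  The present incidences `(a, b, l)` (`walkEps ≠ 0`) of the walk design of a layered graph
`lay` on `T + 1` copies of `V` number at most `m` (diagonal) `+ Σ_t #edges(layer t)` `+ |V|` (back entries). -/
theorem card_support_walkEps_le (ι : Fin (T + 1) × V ≃ Fin m) (lay : Fin T → V → V → Option (WEdge K))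
    (l₀ : Fin K) (v₀ : V) :
    ((univ : Finset (Fin m × Fin m × Fin K)).filter (fun x => walkEps ι lay l₀ v₀ x.1 x.2.1 x.2.2 ≠ 0)).card
      ≤ m + (∑ t : Fin T, ((univ : Finset (V × V)).filter (fun vv => (lay t vv.1 vv.2).isSome)).card)
        + Fintype.card V := by
  classical
  set A : Finset (Fin m × Fin m × Fin K) := (univ : Finset (Fin m)).image (fun a => (a, a, l₀)) with hA
  set R : Finset (Fin m × Fin m × Fin K) :=
    (univ : Finset V).image (fun v => (ι (Fin.last T, v), ι (0, v₀), l₀)) with hR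
  set E : Fin T → Finset (V × V) := fun t => (univ : Finset (V × V)).filter (fun vv => (lay t vv.1 vv.2).isSome) with hE
  set f : Fin T → V × V → Fin m × Fin m × Fin K := fun t vv =>
    (ι (t.castSucc, vv.1), ι (t.succ, vv.2), ((lay t vv.1 vv.2).map WEdge.cls).getD l₀) with hf
  set B : Finset (Fin m × Fin m × Fin K) := (univ : Finset (Fin T)).biUnion (fun t => (E t).image (f t)) with hB
  have hsub : ((univ : Finset (Fin m × Fin m × Fin K)).filter (fun x => walkEps ι lay l₀ v₀ x.1 x.2.1 x.2.2 ≠ 0))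
      ⊆ A ∪ B ∪ R := by
    intro x hx
    rw [mem_filter] at hx
    obtain ⟨a, b, l⟩ := x
    have h : walkEpsP lay l₀ v₀ (ι.symm a) (ι.symm b) l ≠ 0 := hx.2
    rcases walkEpsP_cases lay l₀ v₀ h with ⟨hrc, hl⟩ | ⟨_, e, he, hl⟩ | ⟨_, _, hr, hc1, hc2, hl⟩
    · -- diagonal
      have hab : a = b := ι.symm.injective hrc
      refine mem_union_left _ (mem_union_left _ ?_)
      rw [hA, mem_image]
      exact ⟨a, mem_univ _, by rw [hab, hl]⟩
    · -- a layer edge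
      obtain ⟨hs, hlay⟩ := lay_of_layerEdge lay he
      have hl1 := layer_of_layerEdge lay he
      refine mem_union_left _ (mem_union_right _ ?_)
      rw [hB, mem_biUnion]
      refine ⟨⟨(ι.symm a).1.val, hs⟩, mem_univ _, ?_⟩
      rw [mem_image]
      refine ⟨((ι.symm a).2, (ι.symm b).2), ?_, ?_⟩
      · rw [hE, mem_filter]; exact ⟨mem_univ _, by rw [hlay]; rfl⟩
      · rw [hf]
        simp only
        rw [hlay]
        simp only [Option.map_some, Option.getD_some]
        have h1 : (Fin.castSucc (⟨(ι.symm a).1.val, hs⟩ : Fin T), (ι.symm a).2) = ι.symm a := by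
          refine Prod.ext (Fin.ext rfl) rfl
        have h2 : (Fin.succ (⟨(ι.symm a).1.val, hs⟩ : Fin T), (ι.symm b).2) = ι.symm b := by
          refine Prod.ext (Fin.ext ?_) rfl
          simp only [Fin.val_succ]; omega
        rw [h1, h2, Equiv.apply_symm_apply, Equiv.apply_symm_apply, hl]
    · -- a back entry
      refine mem_union_right _ ?_
      rw [hR, mem_image]
      refine ⟨(ι.symm a).2, mem_univ _, ?_⟩
      have h1 : ((Fin.last T, (ι.symm a).2) : Fin (T + 1) × V) = ι.symm a := Prod.ext hr.symm rfl
      have h2 : ((0, v₀) : Fin (T + 1) × V) = ι.symm b := Prod.ext hc1.symm hc2.symm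
      rw [h1, h2, Equiv.apply_symm_apply, Equiv.apply_symm_apply, hl]
  have hAc : A.card ≤ m := by
    rw [hA]; exact (card_image_le).trans (by simp)
  have hRc : R.card ≤ Fintype.card V := by
    rw [hR]; exact (card_image_le).trans (by simp)
  have hBc : B.card ≤ ∑ t : Fin T, (E t).card := by
    rw [hB]
    exact (card_biUnion_le).trans (sum_le_sum fun t _ => card_image_le)
  calc ((univ : Finset (Fin m × Fin m × Fin K)).filter (fun x => walkEps ι lay l₀ v₀ x.1 x.2.1 x.2.2 ≠ 0)).card
      ≤ (A ∪ B ∪ R).card := card_le_card hsub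
    _ ≤ (A ∪ B).card + R.card := card_union_le _ _
    _ ≤ A.card + B.card + R.card := by have := card_union_le A B; omega
    _ ≤ m + (∑ t : Fin T, (E t).card) + Fintype.card V := by omega

end Generic

/-! ## 2. Layers whose edge heads are determined by the tail and the head's flag have few edges -/

section HeadDet

variable {K : ℕ}

/-- if the head of every edge is determined by its tail and the head's flag, a layer on `W × Bool` has at most `2·|W × Bool|` edges. -/
theorem card_edges_le_of_headDet {W : Type*} [Fintype W] [DecidableEq W] (lay : W × Bool → W × Bool → Option (WEdge K))
    (h : ∀ v v' v'', (lay v v').isSome → (lay v v'').isSome → v'.2 = v''.2 → v' = v'') :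
    ((univ : Finset ((W × Bool) × (W × Bool))).filter (fun vv => (lay vv.1 vv.2).isSome)).card
      ≤ 2 * Fintype.card (W × Bool) := by
  classical
  have hcard : (univ : Finset ((W × Bool) × Bool)).card = 2 * Fintype.card (W × Bool) := by
    rw [card_univ, Fintype.card_prod, Fintype.card_bool]; ring
  rw [← hcard]
  refine card_le_card_of_injOn (fun vv => (vv.1, vv.2.2)) (fun _ _ => mem_coe.mpr (mem_univ _)) ?_
  intro x hx y hy hxy
  rw [mem_coe, mem_filter] at hx hy
  simp only [Prod.mk.injEq] at hxy
  obtain ⟨h1, h2⟩ := hxy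
  have : x.2 = y.2 := h x.1 x.2 y.2 hx.2 (h1 ▸ hy.2) h2
  exact Prod.ext h1 this

/-- head determination transfers to the restriction of a layer to the finite rows. -/
theorem headDet_finLayer (R : ℕ) (lay : WLayer (ℕ × Bool) K)
    (h : ∀ v v' v'' : ℕ × Bool, (lay v v').isSome → (lay v v'').isSome → v'.2 = v''.2 → v' = v'') :
    ∀ v v' v'' : Fin R × Bool, (finLayer R lay v v').isSome → (finLayer R lay v v'').isSome → v'.2 = v''.2 → v' = v'' := by
  intro v v' v'' h1 h2 h3
  have := h (iota R v) (iota R v') (iota R v'') h1 h2 h3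
  exact iota_injective R this

variable (n L : ℕ)

/-- entry layers are head-determined. -/
theorem headDet_entryLayer (k : ℕ) (p : ℤ) : ∀ v v' v'' : ℕ × Bool,
    (entryLayer n L k p v v').isSome → (entryLayer n L k p v v'').isSome → v'.2 = v''.2 → v' = v'' := by
  intro v v' v'' h1 h2 _
  unfold entryLayer at h1 h2
  by_cases c1 : v.2 = false ∧ v'.2 = true ∧ v'.1 = v.1
  · by_cases c2 : v.2 = false ∧ v''.2 = true ∧ v''.1 = v.1
    · exact Prod.ext (c1.2.2.trans c2.2.2.symm) (c1.2.1.trans c2.2.1.symm)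
    · rw [if_neg c2] at h2; exact absurd h2 (by simp)
  · rw [if_neg c1] at h1; exact absurd h1 (by simp)

/-- exit layers are head-determined. -/
theorem headDet_exitLayer : ∀ v v' v'' : ℕ × Bool,
    (exitLayer L v v').isSome → (exitLayer L v v'').isSome → v'.2 = v''.2 → v' = v'' := by
  intro v v' v'' h1 h2 _
  unfold exitLayer at h1 h2
  by_cases c1 : v'.2 = false ∧ v'.1 = v.1
  · by_cases c2 : v''.2 = false ∧ v''.1 = v.1
    · exact Prod.ext (c1.2.trans c2.2.symm) (c1.1.trans c2.1.symm)
    · rw [if_neg c2] at h2; exact absurd h2 (by simp)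
  · rw [if_neg c1] at h1; exact absurd h1 (by simp)

/-- climb layers are head-determined: an up edge ends at `(ρ+1, climb)`, a flat edge at `(ρ, base)`. -/
theorem headDet_climbLayer (k : ℕ) (p : ℤ) (s : ℕ) : ∀ v v' v'' : ℕ × Bool,
    (climbLayer n L k p s v v').isSome → (climbLayer n L k p s v v'').isSome → v'.2 = v''.2 → v' = v'' := by
  intro v v' v'' h1 h2 hflag
  unfold climbLayer at h1 h2
  have k1 : (v'.2 = true ∧ v'.1 = v.1 + 1) ∨ (v'.2 = false ∧ v'.1 = v.1) := by
    by_cases a1 : v.2 = true ∧ v'.2 = true ∧ v'.1 = v.1 + 1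
    · exact Or.inl ⟨a1.2.1, a1.2.2⟩
    · rw [if_neg a1] at h1
      by_cases b1 : v'.2 = false ∧ v'.1 = v.1
      · exact Or.inr b1
      · rw [if_neg b1] at h1; exact absurd h1 (by simp)
  have k2 : (v''.2 = true ∧ v''.1 = v.1 + 1) ∨ (v''.2 = false ∧ v''.1 = v.1) := by
    by_cases a2 : v.2 = true ∧ v''.2 = true ∧ v''.1 = v.1 + 1
    · exact Or.inl ⟨a2.2.1, a2.2.2⟩
    · rw [if_neg a2] at h2
      by_cases b2 : v''.2 = false ∧ v''.1 = v.1
      · exact Or.inr b2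
      · rw [if_neg b2] at h2; exact absurd h2 (by simp)
  rcases k1 with ⟨f1, r1⟩ | ⟨f1, r1⟩ <;> rcases k2 with ⟨f2, r2⟩ | ⟨f2, r2⟩
  · exact Prod.ext (r1.trans r2.symm) (f1.trans f2.symm)
  · rw [f1, f2] at hflag; exact absurd hflag (by decide)
  · rw [f1, f2] at hflag; exact absurd hflag (by decide)
  · exact Prod.ext (r1.trans r2.symm) (f1.trans f2.symm)

/-- every climb layer of `climbs k p s c` is head-determined. -/
theorem headDet_of_mem_climbs (k : ℕ) (p : ℤ) : ∀ (c s : ℕ) (lay : WLayer (ℕ × Bool) (L + 1)), lay ∈ climbs n L k p s c →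
    ∀ v v' v'' : ℕ × Bool, (lay v v').isSome → (lay v v'').isSome → v'.2 = v''.2 → v' = v''
  | 0, s, lay, h => by simp [climbs] at h
  | c + 1, s, lay, h => by
      rw [climbs, List.mem_cons] at h
      rcases h with rfl | h
      · exact headDet_climbLayer n L k p s
      · exact headDet_of_mem_climbs k p c (s + 1) lay h

/-- every layer of the staircase gadget `J_k(p)` is head-determined. -/
theorem headDet_of_mem_stairJ (k : ℕ) (p : ℤ) (lay : WLayer (ℕ × Bool) (L + 1)) (h : lay ∈ stairJ n L k p) :
    ∀ v v' v'' : ℕ × Bool, (lay v v').isSome → (lay v v'').isSome → v'.2 = v''.2 → v' = v'' := by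
  rw [stairJ, List.mem_cons, List.mem_append, List.mem_singleton] at h
  rcases h with rfl | h | rfl
  · exact headDet_entryLayer n L k p
  · exact headDet_of_mem_climbs n L k p _ _ lay h
  · exact headDet_exitLayer L

/-- every layer of the recursive gadget `𝒢_k(p)` is head-determined. -/
theorem headDet_of_mem_gad : ∀ (k : ℕ) (p : ℤ) (lay : WLayer (ℕ × Bool) (L + 1)), lay ∈ gad n L k p →
    ∀ v v' v'' : ℕ × Bool, (lay v v').isSome → (lay v v'').isSome → v'.2 = v''.2 → v' = v''
  | 0, p, lay, h => by simp [gad] at h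
  | k + 1, p, lay, h => by
      rw [gad, List.mem_append, List.mem_append] at h
      rcases h with h | h | h
      · exact headDet_of_mem_gad k _ lay h
      · exact headDet_of_mem_stairJ n L (k + 1) p lay h
      · exact headDet_of_mem_gad k _ lay h

/-- **every layer of the finite staircase graph has at most `2·|Fin R × Bool| = 4R` edges.** -/
theorem card_edges_staircase_layer_le (R k : ℕ) (p : ℤ) (lay : WLayer (ℕ × Bool) (L + 1)) (h : lay ∈ gad n L k p) :
    ((univ : Finset ((Fin R × Bool) × (Fin R × Bool))).filter (fun vv => (finLayer R lay vv.1 vv.2).isSome)).card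
      ≤ 2 * Fintype.card (Fin R × Bool) :=
  card_edges_le_of_headDet (finLayer R lay) (headDet_finLayer R lay (headDet_of_mem_gad n L k p lay h))

end HeadDet

end StaircaseIncidences

end Summit.ValiantsHypothesis.ValiantsHypothesis.Theorems.KPlusLogSqLaw
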